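import Literature.NumberTheory.EllipticCurves.BinaryQuarticRealTypesProofs
import Literature.NumberTheory.EllipticCurves.BinaryQuarticMinimisationPrimeProofs
import Mathlib.Topology.Order.IntermediateValue
import Mathlib.Analysis.SpecialFunctions.Pow.Real
import HarnessLib

/-!
# Real orbits of binary quartic forms: Bhargava–Shankar's normal form `x³y − (I/3)xy³ − (J/27)y⁴`
# under `SL₂^{±}(ℝ)`, and a bounded normal form for definite forms

`Proofs` companion of `BinaryQuarticForms.lean` (theorems only: no definitions, no named facts),
on the archimedean reduction theory behind Bhargava–Shankar's Thm 2.1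
(`Literature.NumberTheory.EllipticCurves.bhargavaShankar_classCount`): M. Bhargava, A. Shankar,
*Binary quartic forms having bounded invariants, and the boundedness of the average rank of
elliptic curves*, Ann. of Math. (2) 181 (2015) 191–242, §2.1 ("facts 1–2": the real forms with
given invariants `I`, `J`, `4I³ − J² ≠ 0`, form one `SL₂^{±}(ℝ)`-orbit in `V_ℝ^{(1)}` if
`4I³ − J² < 0` and one orbit in each of `V_ℝ^{(0)}`, `V_ℝ^{(2+)}`, `V_ℝ^{(2−)}` if `4I³ − J² > 0`,
whence the fundamental sets `L_V^{(i)}`) and the proof of Prop. 2.8 (held arXiv text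
`arXiv:1006.1002v2`, p. 12: "We first apply an `SL₂`-transformation … to send one of its four
distinct roots in `ℙ¹` to the point `[1:0]`. The resulting quartic is of the form
`bx³y + cx²y² + dxy³ + ey⁴` with `b ≠ 0`. Secondly, we use a diagonal matrix and then a lower
triangular matrix … to transform the quartic into the form `x³y + d'xy³ + e'y⁴`. Because this
quartic still has invariants equal to `I` and `J`, we see that it is in fact equal to
`q_{I,J} = x³y − (I/3)xy³ − (J/27)y⁴`").

## Contents (all proved)

1. `a = b = 0 ⇒ Δ = 0` (`disc_eq_zero_of_a_eq_zero_of_b_eq_zero`); the invariants of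
   `q_{I,J}` (`I_qForm`, `J_qForm`, `disc_qForm`). (Shears and diagonal substitutions are those of
   `BinaryQuarticMinimisationPrimeProofs`: `subst_lowerShear`, `subst_diagonal`.)
2. `exists_subst_eq_qForm_of_eval_eq_zero`: **every real form `f` with `Δ(f) ≠ 0` having a zero in
   `ℙ¹(ℝ)` is `SL₂^{±}(ℝ)`-equivalent to `q_{I(f),J(f)} = x³y − (I/3)xy³ − (J/27)y⁴`**: there is a
   real `γ` with `det γ = ±1` and `γ · f = q_{I(f),J(f)}` (the three printed steps, over `ℝ`, where
   the diagonal step needs `det = −1` when `b < 0`); equivalently `f = γ' · q_{I(f),J(f)}`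
   (`exists_eq_qForm_subst_of_eval_eq_zero`).
3. `not_isDefinite_iff_exists_eval_eq_zero`: a real form is not definite iff it vanishes at a
   nonzero vector ("`V_ℝ^{(2)}` is the set of definite forms", §2.1; intermediate value theorem
   along a segment). Hence item 2 applies to every `f ∈ V_ℝ^{(0)} ∪ V_ℝ^{(1)}`
   (`exists_subst_eq_qForm_of_disc_neg`, `exists_subst_eq_qForm_of_not_isDefinite`): for fixed
   `(I, J)` these forms lie in the single `SL₂^{±}(ℝ)`-orbit of `q_{I,J}` (facts 1–2 for
   `i = 0, 1`), and `q_{I,J}` has invariants `(I, J)` (`I_qForm`, `J_qForm`).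
4. `exists_subst_eq_circleForm_of_posDef`: **a positive definite real form is `SL₂(ℝ)`-equivalent
   to `(x² + y²)(Px² + Qxy + Ry²)` with `P, R > 0`, `Q² < 4PR`** (factor `f(x,1)` into two definite
   real quadratics, `Irreducible.natDegree_le_two`, and move the first to a multiple of `x² + y²`),
   and such a form has all coefficients bounded in terms of `I` alone:
   `(P + R)² < I = 12PR − 3Q² + (P+R)²`, `|Q| < P + R` (`circleForm_bounds`). Together with 2–3 this
   gives, for every real form with `Δ ≠ 0`, an `SL₂^{±}(ℝ)`-equivalent form whose coefficients are
   bounded in terms of `H(f)` — the compactness of the fundamental sets `L_V^{(i)}` used in §2.1–2.3.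

## References

* M. Bhargava, A. Shankar, Ann. of Math. (2) 181 (2015) 191–242 = arXiv:1006.1002, §2.1
  (facts 1–2, fundamental sets `L_V^{(i)}`) and proof of Prop. 2.8.
  [cite: BhargavaShankarAnnals2015, §2.1 and proof of Prop. 2.8 (arXiv:1006.1002v2 numbering)]
-/

noncomputable section

open scoped Classical
open Polynomial

namespace Literature.NumberTheory.EllipticCurves

namespace BinaryQuartic

/-! ## §1 The normal form `q_{I,J}` -/

section Special

variable {R : Type*} [CommRing R]

/-- A binary quartic form with `a = b = 0` (i.e. divisible by `y²`) has discriminant `0`. [folklore] -/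
theorem disc_eq_zero_of_a_eq_zero_of_b_eq_zero {f : BinaryQuartic R} (ha : f.a = 0) (hb : f.b = 0) :
    f.disc = 0 := by
  simp [disc, ha, hb]

/-- A form `x³y + dxy³ + ey⁴` (`a = 0`, `b = 1`, `c = 0`) has `I = −3d` and `J = −27e`, so it is
`q_{I,J} = x³y − (I/3)xy³ − (J/27)y⁴` (Bhargava–Shankar 2015, proof of Prop. 2.8: "Because this
quartic still has invariants equal to `I` and `J`, we see that it is in fact equal to `q_{I,J}`").
[cite: BhargavaShankarAnnals2015, proof of Prop. 2.8 (arXiv:1006.1002v2 numbering)] -/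
theorem eq_qForm_of_abc {K : Type*} [Field K] [CharZero K] {g : BinaryQuartic K} (ha : g.a = 0)
    (hb : g.b = 1) (hc : g.c = 0) : g = ⟨0, 1, 0, -g.I / 3, -g.J / 27⟩ := by
  ext
  · exact ha
  · exact hb
  · exact hc
  · simp only [I, ha, hb, hc]; ring
  · simp only [J, ha, hb, hc]; ring

/-- `q_{I,J} = x³y − (I/3)xy³ − (J/27)y⁴` has invariant `I`. [cite: BhargavaShankarAnnals2015, proof of Prop. 2.8 ("q_{I,J} has invariants equal to I and J"; arXiv:1006.1002v2 numbering)] -/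
theorem I_qForm {K : Type*} [Field K] [CharZero K] (I₀ J₀ : K) :
    (⟨0, 1, 0, -I₀ / 3, -J₀ / 27⟩ : BinaryQuartic K).I = I₀ := by
  simp only [I]; field_simp; ring

/-- `q_{I,J} = x³y − (I/3)xy³ − (J/27)y⁴` has invariant `J`. [cite: BhargavaShankarAnnals2015, proof of Prop. 2.8 ("q_{I,J} has invariants equal to I and J"; arXiv:1006.1002v2 numbering)] -/
theorem J_qForm {K : Type*} [Field K] [CharZero K] (I₀ J₀ : K) :
    (⟨0, 1, 0, -I₀ / 3, -J₀ / 27⟩ : BinaryQuartic K).J = J₀ := by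
  simp only [J]; field_simp; ring

/-- The discriminant of `q_{I,J}` is `(4I³ − J²)/27`. [cite: BhargavaShankarAnnals2015, §2 (Δ = (4I³ − J²)/27)] -/
theorem disc_qForm {K : Type*} [Field K] [CharZero K] (I₀ J₀ : K) :
    (⟨0, 1, 0, -I₀ / 3, -J₀ / 27⟩ : BinaryQuartic K).disc = (4 * I₀ ^ 3 - J₀ ^ 2) / 27 := by
  simp only [disc]; field_simp; ring

end Special

/-! ## §2 Forms with a real zero: reduction to `q_{I,J}` -/

section RealZero

/-- An invertible substitution takes nonzero vectors to nonzero vectors: if `det γ ≠ 0` and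
`(x, y) ≠ 0` then `(x, y)γ ≠ 0`. [folklore] -/
theorem row_ne_zero {K : Type*} [Field K] {γ : Matrix (Fin 2) (Fin 2) K} (hγ : γ.det ≠ 0)
    {x y : K} (hxy : x ≠ 0 ∨ y ≠ 0) :
    x * γ 0 0 + y * γ 1 0 ≠ 0 ∨ x * γ 0 1 + y * γ 1 1 ≠ 0 := by
  by_contra h0
  simp only [ne_eq, not_or, not_not] at h0
  obtain ⟨h1, h2⟩ := h0
  have hx : x * γ.det = 0 := by
    rw [Matrix.det_fin_two]; linear_combination γ 1 1 * h1 - γ 1 0 * h2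
  have hy : y * γ.det = 0 := by
    rw [Matrix.det_fin_two]; linear_combination (-(γ 0 1)) * h1 + γ 0 0 * h2
  rcases hxy with hx0 | hy0
  · exact hx0 ((mul_eq_zero.mp hx).resolve_right hγ)
  · exact hy0 ((mul_eq_zero.mp hy).resolve_right hγ)

/-- **Step 1** (move a real zero to `[1:0]`): if `f(x₀, y₀) = 0` with `(x₀, y₀) ≠ 0`, the rotation-like
matrix `γ = (x₀ y₀; −y₀/r x₀/r)`, `r = x₀² + y₀²`, has `det γ = 1` and `(γ · f)` has `a = 0`
(Bhargava–Shankar 2015, proof of Prop. 2.8, first step). [cite: BhargavaShankarAnnals2015, proof of Prop. 2.8 (arXiv:1006.1002v2 numbering)] -/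
theorem exists_subst_a_eq_zero_of_eval_eq_zero {f : BinaryQuartic ℝ} {x₀ y₀ : ℝ}
    (hne : x₀ ≠ 0 ∨ y₀ ≠ 0) (h0 : f.eval x₀ y₀ = 0) :
    ∃ γ : Matrix (Fin 2) (Fin 2) ℝ, γ.det = 1 ∧ (f.subst γ).a = 0 := by
  set r : ℝ := x₀ ^ 2 + y₀ ^ 2 with hr
  have hrpos : 0 < r := by
    rcases hne with h | h
    · have := sq_pos_of_ne_zero h; positivity
    · have := sq_pos_of_ne_zero h; positivity
  refine ⟨!![x₀, y₀; -y₀ / r, x₀ / r], ?_, ?_⟩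
  · rw [Matrix.det_fin_two]
    simp only [Matrix.of_apply, Matrix.cons_val', Matrix.cons_val_zero, Matrix.cons_val_one,
      Matrix.cons_val_fin_one, Matrix.empty_val']
    field_simp
    ring
  · rw [subst_a]
    simpa using h0

/-- **Steps 2–3** (from `a = 0`, `b ≠ 0` to `q_{I,J}`): a lower unipotent substitution kills `c`,
then a diagonal one of determinant `sign(b) = ±1` makes `b = 1`; the result has invariants
`(I, J) = (I(g), J(g))` and is therefore `q_{I(g),J(g)}` (Bhargava–Shankar 2015, proof of Prop. 2.8,
second step; over `ℝ` the diagonal matrix `diag(|b|^{-1/2}, ±|b|^{1/2})` is needed, of determinant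
`−1` when `b < 0`). [cite: BhargavaShankarAnnals2015, proof of Prop. 2.8 (arXiv:1006.1002v2 numbering)] -/
theorem exists_subst_eq_qForm_of_a_eq_zero {g : BinaryQuartic ℝ} (ha : g.a = 0) (hb : g.b ≠ 0) :
    ∃ γ : Matrix (Fin 2) (Fin 2) ℝ, (γ.det = 1 ∨ γ.det = -1) ∧
      g.subst γ = ⟨0, 1, 0, -g.I / 3, -g.J / 27⟩ := by
  -- the sign `σ = ±1` of `b` and `s = |b|^{1/2}`
  obtain ⟨σ, hσ, hσb⟩ : ∃ σ : ℝ, (σ = 1 ∨ σ = -1) ∧ σ * g.b = |g.b| := by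
    rcases lt_or_gt_of_ne hb with h | h
    · exact ⟨-1, Or.inr rfl, by rw [abs_of_neg h]; ring⟩
    · exact ⟨1, Or.inl rfl, by rw [abs_of_pos h]; ring⟩
  set s : ℝ := Real.sqrt |g.b| with hs
  have habs : 0 < |g.b| := abs_pos.mpr hb
  have hs0 : 0 < s := Real.sqrt_pos.mpr habs
  have hss : s ^ 2 = |g.b| := Real.sq_sqrt habs.le
  set u : ℝ := -g.c / (3 * g.b) with hu
  set N : Matrix (Fin 2) (Fin 2) ℝ := !![1, 0; u, 1] with hN
  set D : Matrix (Fin 2) (Fin 2) ℝ := !![s⁻¹, 0; 0, σ * s] with hD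
  have hdet : (D * N).det = σ := by
    rw [Matrix.det_mul, hD, hN, Matrix.det_fin_two_of, det_lowerShear, mul_one]
    field_simp
    ring
  refine ⟨D * N, hdet ▸ hσ, ?_⟩
  · have hdet4 : (D * N).det ^ 4 = 1 := by
      rw [hdet]; rcases hσ with h | h <;> norm_num [h]
    have hdet6 : (D * N).det ^ 6 = 1 := by
      rw [hdet]; rcases hσ with h | h <;> norm_num [h]
    have hI : (g.subst (D * N)).I = g.I := by rw [I_subst, hdet4, one_mul]
    have hJ : (g.subst (D * N)).J = g.J := by rw [J_subst, hdet6, one_mul]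
    rw [← hI, ← hJ]
    apply eq_qForm_of_abc
    · rw [subst_mul, hN, subst_lowerShear, hD, subst_diagonal]
      simp [ha]
    · rw [subst_mul, hN, subst_lowerShear, hD, subst_diagonal]
      simp only [ha, mul_zero, zero_mul, zero_add]
      have : g.b * s⁻¹ ^ 3 * (σ * s) = (σ * g.b) * (s ^ 2)⁻¹ := by
        field_simp
      rw [this, hσb, hss, mul_inv_cancel₀ habs.ne']
    · rw [subst_mul, hN, subst_lowerShear, hD, subst_diagonal]
      simp only [ha, mul_zero, zero_mul, zero_add, hu]
      have : 3 * g.b * (-g.c / (3 * g.b)) + g.c = 0 := by field_simp; ring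
      rw [this, zero_mul, zero_mul]

/-- **A real binary quartic form with `Δ ≠ 0` and a zero in `ℙ¹(ℝ)` is `SL₂^{±}(ℝ)`-equivalent to
`q_{I,J} = x³y − (I/3)xy³ − (J/27)y⁴`, `(I, J) = (I(f), J(f))`**: `γ · f = q_{I(f),J(f)}` for some real
`γ` with `det γ = ±1` (Bhargava–Shankar 2015, §2.1 facts 1–2 and proof of Prop. 2.8; `b ≠ 0` after
step 1 because `a = b = 0` would force `Δ = 0`). [cite: BhargavaShankarAnnals2015, §2.1 (facts 1–2) and proof of Prop. 2.8 (arXiv:1006.1002v2 numbering)] -/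
theorem exists_subst_eq_qForm_of_eval_eq_zero {f : BinaryQuartic ℝ} (hΔ : f.disc ≠ 0)
    (hz : ∃ x y : ℝ, (x ≠ 0 ∨ y ≠ 0) ∧ f.eval x y = 0) :
    ∃ γ : Matrix (Fin 2) (Fin 2) ℝ, (γ.det = 1 ∨ γ.det = -1) ∧
      f.subst γ = ⟨0, 1, 0, -f.I / 3, -f.J / 27⟩ := by
  obtain ⟨x₀, y₀, hne, h0⟩ := hz
  obtain ⟨γ₁, hγ₁, ha⟩ := exists_subst_a_eq_zero_of_eval_eq_zero hne h0
  have hb : (f.subst γ₁).b ≠ 0 := by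
    intro hb
    have h := disc_eq_zero_of_a_eq_zero_of_b_eq_zero ha hb
    rw [disc_subst, hγ₁, one_pow, one_mul] at h
    exact hΔ h
  obtain ⟨γ₂, hγ₂, hq⟩ := exists_subst_eq_qForm_of_a_eq_zero ha hb
  refine ⟨γ₂ * γ₁, ?_, ?_⟩
  · rw [Matrix.det_mul, hγ₁, mul_one]; exact hγ₂
  · have hI : (f.subst γ₁).I = f.I := by rw [I_subst, hγ₁, one_pow, one_mul]
    have hJ : (f.subst γ₁).J = f.J := by rw [J_subst, hγ₁, one_pow, one_mul]
    rw [subst_mul, hq, hI, hJ]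

/-- The same, solved for `f`: **`f = γ · q_{I(f),J(f)}` for some real `γ` with `det γ = ±1`**.
[cite: BhargavaShankarAnnals2015, §2.1 (facts 1–2) and proof of Prop. 2.8 (arXiv:1006.1002v2 numbering)] -/
theorem exists_eq_qForm_subst_of_eval_eq_zero {f : BinaryQuartic ℝ} (hΔ : f.disc ≠ 0)
    (hz : ∃ x y : ℝ, (x ≠ 0 ∨ y ≠ 0) ∧ f.eval x y = 0) :
    ∃ γ : Matrix (Fin 2) (Fin 2) ℝ, (γ.det = 1 ∨ γ.det = -1) ∧
      f = (⟨0, 1, 0, -f.I / 3, -f.J / 27⟩ : BinaryQuartic ℝ).subst γ := by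
  obtain ⟨γ, hγ, hq⟩ := exists_subst_eq_qForm_of_eval_eq_zero hΔ hz
  have hγ0 : γ.det ≠ 0 := by rcases hγ with h | h <;> rw [h] <;> norm_num
  have hγu : IsUnit γ.det := isUnit_iff_ne_zero.mpr hγ0
  refine ⟨γ⁻¹, ?_, ?_⟩
  · rw [Matrix.det_nonsing_inv, Ring.inverse_eq_inv']
    rcases hγ with h | h <;> simp [h]
  · rw [← hq, ← subst_mul, Matrix.nonsing_inv_mul γ hγu, subst_one]

end RealZero

/-! ## §3 Indefinite forms vanish somewhere; facts 1–2 for `i = 0, 1` -/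

section Indefinite

/-- `f` is continuous along a segment: `s ↦ f((1−s)v₁ + s v₂)` is continuous. [folklore] -/
theorem continuous_eval_segment (f : BinaryQuartic ℝ) (x₁ y₁ x₂ y₂ : ℝ) :
    Continuous fun s : ℝ ↦ f.eval ((1 - s) * x₁ + s * x₂) ((1 - s) * y₁ + s * y₂) := by
  unfold eval
  fun_prop

/-- **A real binary quartic form is not definite iff it vanishes at some nonzero vector**
(Bhargava–Shankar 2015, §2.1: "`V_ℝ^{(2)}` [no real roots] is the set of definite forms in `V_ℝ`,
i.e., forms that take only positive or only negative values when evaluated at nonzero vectors").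
If `f(v₁) < 0 < f(v₂)`, the segment from `v₁` to `v₂` avoids `0` (a point `c v₁`, `c ≤ 0`, of it
would have `f = c⁴ f(v₁) ≤ 0`), and `f` vanishes on it by the intermediate value theorem.
[cite: BhargavaShankarAnnals2015, §2.1 (V_ℝ^{(2)} = definite forms)] -/
theorem not_isDefinite_iff_exists_eval_eq_zero (f : BinaryQuartic ℝ) :
    ¬ f.IsDefinite ↔ ∃ x y : ℝ, (x ≠ 0 ∨ y ≠ 0) ∧ f.eval x y = 0 := by
  constructor
  · intro hnd
    simp only [IsDefinite, not_or, not_forall, not_lt, exists_prop] at hnd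
    obtain ⟨⟨x₁, y₁, h₁, hle⟩, ⟨x₂, y₂, h₂, hge⟩⟩ := hnd
    rcases hle.lt_or_eq with hlt | heq
    swap; · exact ⟨x₁, y₁, h₁, heq⟩
    rcases hge.lt_or_eq with hgt | heq
    swap; · exact ⟨x₂, y₂, h₂, heq.symm⟩
    -- `f(v₁) < 0 < f(v₂)`: intermediate value theorem on the segment
    set g : ℝ → ℝ := fun s ↦ f.eval ((1 - s) * x₁ + s * x₂) ((1 - s) * y₁ + s * y₂) with hg
    have hg0 : g 0 = f.eval x₁ y₁ := by simp [hg]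
    have hg1 : g 1 = f.eval x₂ y₂ := by simp [hg]
    have hcont : ContinuousOn g (Set.Icc 0 1) := (continuous_eval_segment f x₁ y₁ x₂ y₂).continuousOn
    have hmem : (0 : ℝ) ∈ Set.Icc (g 0) (g 1) := ⟨by rw [hg0]; exact hlt.le, by rw [hg1]; exact hgt.le⟩
    obtain ⟨s, hs, hs0⟩ := intermediate_value_Icc zero_le_one hcont hmem
    refine ⟨(1 - s) * x₁ + s * x₂, (1 - s) * y₁ + s * y₂, ?_, hs0⟩
    -- the zero is a nonzero vector
    by_contra hv
    simp only [not_or, not_not] at hv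
    obtain ⟨hvx, hvy⟩ := hv
    have hs1 : s ≠ 0 := by
      rintro rfl
      simp only [sub_zero, one_mul, zero_mul, add_zero] at hvx hvy
      rcases h₁ with h | h
      · exact h hvx
      · exact h hvy
    -- `v₂ = c • v₁` with `c = -(1-s)/s ≤ 0`
    set c : ℝ := -(1 - s) / s with hc
    have hx₂ : x₂ = c * x₁ := by rw [hc]; field_simp; linear_combination hvx
    have hy₂ : y₂ = c * y₁ := by rw [hc]; field_simp; linear_combination hvy
    have hval : f.eval x₂ y₂ = c ^ 4 * f.eval x₁ y₁ := by rw [hx₂, hy₂, eval_mul_mul]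
    have : c ^ 4 * f.eval x₁ y₁ ≤ 0 :=
      mul_nonpos_of_nonneg_of_nonpos (by positivity) hlt.le
    linarith
  · rintro ⟨x, y, hxy, h0⟩ (hpos | hneg)
    · exact (hpos x y hxy).ne' h0
    · exact (hneg x y hxy).ne h0

/-- **Fact 1 (existence half), `i = 1`**: a real form with `Δ < 0` is `SL₂^{±}(ℝ)`-equivalent to
`q_{I(f),J(f)}` (it has a real zero, `exists_eval_eq_zero_of_disc_neg`). So all real forms with
given invariants `(I, J)`, `4I³ − J² < 0`, lie in the single `SL₂^{±}(ℝ)`-orbit of `q_{I,J}`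
(Bhargava–Shankar 2015, §2.1, fact 1). [cite: BhargavaShankarAnnals2015, §2.1 (fact 1)] -/
theorem exists_subst_eq_qForm_of_disc_neg {f : BinaryQuartic ℝ} (hΔ : f.disc < 0) :
    ∃ γ : Matrix (Fin 2) (Fin 2) ℝ, (γ.det = 1 ∨ γ.det = -1) ∧
      f.subst γ = ⟨0, 1, 0, -f.I / 3, -f.J / 27⟩ :=
  exists_subst_eq_qForm_of_eval_eq_zero hΔ.ne (exists_eval_eq_zero_of_disc_neg f hΔ)

/-- **Fact 2 (existence half), `i = 0`**: a real form with `Δ ≠ 0` which is not definite is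
`SL₂^{±}(ℝ)`-equivalent to `q_{I(f),J(f)}`. So all forms of `V_ℝ^{(0)}` (`Δ > 0`, indefinite) with
given invariants `(I, J)` lie in the single `SL₂^{±}(ℝ)`-orbit of `q_{I,J}` (Bhargava–Shankar 2015,
§2.1, fact 2, the orbit "from `V_ℝ^{(0)}`"). [cite: BhargavaShankarAnnals2015, §2.1 (fact 2)] -/
theorem exists_subst_eq_qForm_of_not_isDefinite {f : BinaryQuartic ℝ} (hΔ : f.disc ≠ 0)
    (hnd : ¬ f.IsDefinite) :
    ∃ γ : Matrix (Fin 2) (Fin 2) ℝ, (γ.det = 1 ∨ γ.det = -1) ∧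
      f.subst γ = ⟨0, 1, 0, -f.I / 3, -f.J / 27⟩ :=
  exists_subst_eq_qForm_of_eval_eq_zero hΔ ((not_isDefinite_iff_exists_eval_eq_zero f).mp hnd)

/-- Conversely, `q_{I,J}` vanishes at `[1:0]`, so every form in its `SL₂^{±}(ℝ)`-orbit (indeed
every `γ · q_{I,J}` with `det γ ≠ 0`) has a real zero and is not definite: the orbit of `q_{I,J}`
does not meet `V_ℝ^{(2)}`. [cite: BhargavaShankarAnnals2015, §2.1 (facts 1–2)] -/
theorem not_isDefinite_qForm_subst (I₀ J₀ : ℝ) {γ : Matrix (Fin 2) (Fin 2) ℝ} (hγ : γ.det ≠ 0) :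
    ¬ ((⟨0, 1, 0, -I₀ / 3, -J₀ / 27⟩ : BinaryQuartic ℝ).subst γ).IsDefinite := by
  rw [isDefinite_subst_iff _ hγ, not_isDefinite_iff_exists_eval_eq_zero]
  exact ⟨1, 0, Or.inl one_ne_zero, by simp [eval]⟩

/-- For integral forms: every `f ∈ V_ℤ^{(0)} ∪ V_ℤ^{(1)}` (`fourRealRoots ∪ twoRealRoots`) becomes,
over `ℝ`, `SL₂^{±}(ℝ)`-equivalent to `q_{I(f),J(f)}` (Bhargava–Shankar 2015, §2.1: the
fundamental sets `L_V^{(0)}`, `L_V^{(1)}` consist of such forms with `H(I,J) = 1`).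
[cite: BhargavaShankarAnnals2015, §2.1 (facts 1–2, fundamental sets L_V^{(i)})] -/
theorem exists_subst_eq_qForm_of_mem_union {f : BinaryQuartic ℤ}
    (hf : f ∈ fourRealRoots ∪ twoRealRoots) :
    ∃ γ : Matrix (Fin 2) (Fin 2) ℝ, (γ.det = 1 ∨ γ.det = -1) ∧
      (f.map (Int.castRingHom ℝ)).subst γ = ⟨0, 1, 0, -(f.I : ℝ) / 3, -(f.J : ℝ) / 27⟩ := by
  have hI : ((f.map (Int.castRingHom ℝ)).I : ℝ) = f.I := by rw [I_map, eq_intCast]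
  have hJ : ((f.map (Int.castRingHom ℝ)).J : ℝ) = f.J := by rw [J_map, eq_intCast]
  rw [← hI, ← hJ]
  rcases hf with hf | hf
  · obtain ⟨hdisc, hnd⟩ := hf
    refine exists_subst_eq_qForm_of_not_isDefinite ?_ hnd
    rw [disc_map, eq_intCast]; exact_mod_cast hdisc.ne'
  · refine exists_subst_eq_qForm_of_disc_neg ?_
    rw [disc_map, eq_intCast]; exact_mod_cast (show f.disc < 0 from hf)

end Indefinite

/-! ## §4 Definite forms: the normal form `(x² + y²)(Px² + Qxy + Ry²)` -/

section Definite

/-- **A real quartic `f(x,1)` of degree `4` without real roots is a product of two real quadratics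
without real roots**: there are `αᵢ, βᵢ, γᵢ` with `f(x,y) = (α₁x² + β₁xy + γ₁y²)(α₂x² + β₂xy + γ₂y²)`
coefficientwise and `βᵢ² − 4αᵢγᵢ < 0` (irreducible real polynomials have degree `≤ 2`,
`Irreducible.natDegree_le_two`; the argument of `exists_eval_eq_zero_of_disc_neg`). [folklore] -/
theorem exists_quadratic_factors {f : BinaryQuartic ℝ} (ha : f.a ≠ 0)
    (hnoroot : ∀ x : ℝ, f.toPoly.eval x ≠ 0) :
    ∃ α₁ β₁ γ₁ α₂ β₂ γ₂ : ℝ, f.a = α₁ * α₂ ∧ f.b = α₁ * β₂ + β₁ * α₂ ∧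
      f.c = α₁ * γ₂ + β₁ * β₂ + γ₁ * α₂ ∧ f.d = β₁ * γ₂ + γ₁ * β₂ ∧ f.e = γ₁ * γ₂ ∧
      β₁ ^ 2 - 4 * α₁ * γ₁ < 0 ∧ β₂ ^ 2 - 4 * α₂ * γ₂ < 0 := by
  have hdeg : f.toPoly.natDegree = 4 := natDegree_toPoly ha
  -- an irreducible factor `q` of degree `1` or `2`
  set q := f.toPoly.factor with hq
  have hqirr : Irreducible q := irreducible_factor _
  have hqdvd : q ∣ f.toPoly := factor_dvd_of_natDegree_ne_zero (by rw [hdeg]; norm_num)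
  obtain ⟨h, hgh⟩ := hqdvd
  have hq0 : q ≠ 0 := hqirr.ne_zero
  have hh0 : h ≠ 0 := by
    rintro rfl; rw [mul_zero] at hgh; exact toPoly_ne_zero ha hgh
  have hqdeg2 : q.natDegree ≤ 2 := hqirr.natDegree_le_two
  have hqdeg1 : 1 ≤ q.natDegree := by
    have := Polynomial.natDegree_pos_iff_degree_pos.mpr (degree_pos_of_irreducible hqirr)
    omega
  have hsum : q.natDegree + h.natDegree = 4 := by
    rw [← hdeg, hgh, natDegree_mul hq0 hh0]
  -- no factor of `f(x,1)` has a real root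
  have hq_noroot : ∀ x : ℝ, q.eval x ≠ 0 := fun x hx ↦
    hnoroot x (by rw [hgh, eval_mul, hx, zero_mul])
  have hh_noroot : ∀ x : ℝ, h.eval x ≠ 0 := fun x hx ↦
    hnoroot x (by rw [hgh, eval_mul, hx, mul_zero])
  -- `q` cannot be linear
  have hqdeg : q.natDegree = 2 := by
    rcases Nat.lt_or_ge q.natDegree 2 with hlt | hge
    · exfalso
      have h1 : q.natDegree = 1 := by omega
      obtain ⟨c0, hc0⟩ : ∃ c0, q.coeff 0 = c0 := ⟨_, rfl⟩
      obtain ⟨c1, hc1'⟩ : ∃ c1, q.coeff 1 = c1 := ⟨_, rfl⟩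
      have hq1 : q = C c1 * X + C c0 := by
        rw [← hc0, ← hc1']; exact eq_X_add_C_of_natDegree_le_one h1.le
      have hc1 : c1 ≠ 0 := by
        intro h0
        have := congrArg natDegree hq1
        rw [h0, map_zero, zero_mul, zero_add, natDegree_C] at this
        omega
      apply hq_noroot (-c0 / c1)
      rw [hq1]
      simp only [eval_add, eval_mul, eval_C, eval_X]
      field_simp
      ring
    · omega
  have hhdeg : h.natDegree = 2 := by omega
  -- write both quadratics explicitly
  have hq2 : q = C (q.coeff 2) * X ^ 2 + C (q.coeff 1) * X + C (q.coeff 0) := by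
    conv_lhs => rw [q.as_sum_range_C_mul_X_pow, hqdeg]
    simp [Finset.sum_range_succ]
    ring
  have hh2 : h = C (h.coeff 2) * X ^ 2 + C (h.coeff 1) * X + C (h.coeff 0) := by
    conv_lhs => rw [h.as_sum_range_C_mul_X_pow, hhdeg]
    simp [Finset.sum_range_succ]
    ring
  have hqlead : q.coeff 2 ≠ 0 := by
    have := hq0; contrapose! this
    rw [← leadingCoeff_eq_zero, leadingCoeff, hqdeg, this]
  have hhlead : h.coeff 2 ≠ 0 := by
    have := hh0; contrapose! this
    rw [← leadingCoeff_eq_zero, leadingCoeff, hhdeg, this]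
  -- negative discriminants
  have hdq : q.coeff 1 ^ 2 - 4 * q.coeff 2 * q.coeff 0 < 0 := by
    refine discrim_neg_of_no_root hqlead fun x hx ↦ hq_noroot x ?_
    rw [hq2]; simp only [eval_add, eval_mul, eval_C, eval_X, eval_pow]; linear_combination hx
  have hdh : h.coeff 1 ^ 2 - 4 * h.coeff 2 * h.coeff 0 < 0 := by
    refine discrim_neg_of_no_root hhlead fun x hx ↦ hh_noroot x ?_
    rw [hh2]; simp only [eval_add, eval_mul, eval_C, eval_X, eval_pow]; linear_combination hx
  -- compare coefficients of `f(x,1) = q h`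
  have hprod : f.toPoly = C (q.coeff 2 * h.coeff 2) * X ^ 4 +
      C (q.coeff 2 * h.coeff 1 + q.coeff 1 * h.coeff 2) * X ^ 3 +
      C (q.coeff 2 * h.coeff 0 + q.coeff 1 * h.coeff 1 + q.coeff 0 * h.coeff 2) * X ^ 2 +
      C (q.coeff 1 * h.coeff 0 + q.coeff 0 * h.coeff 1) * X + C (q.coeff 0 * h.coeff 0) := by
    rw [hgh]
    conv_lhs => rw [hq2, hh2]
    exact quadratic_mul_quadratic _ _ _ _ _ _
  have hf : f.toPoly = C f.a * X ^ 4 + C f.b * X ^ 3 + C f.c * X ^ 2 + C f.d * X + C f.e := rfl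
  have hcoef : ∀ n, (C f.a * X ^ 4 + C f.b * X ^ 3 + C f.c * X ^ 2 + C f.d * X + C f.e).coeff n =
      (C (q.coeff 2 * h.coeff 2) * X ^ 4 +
      C (q.coeff 2 * h.coeff 1 + q.coeff 1 * h.coeff 2) * X ^ 3 +
      C (q.coeff 2 * h.coeff 0 + q.coeff 1 * h.coeff 1 + q.coeff 0 * h.coeff 2) * X ^ 2 +
      C (q.coeff 1 * h.coeff 0 + q.coeff 0 * h.coeff 1) * X + C (q.coeff 0 * h.coeff 0)).coeff n := by
    intro n; rw [← hf, ← hprod]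
  have ha' := hcoef 4
  have hb' := hcoef 3
  have hc' := hcoef 2
  have hd' := hcoef 1
  have he' := hcoef 0
  simp only [coeff_explicit_quartic] at ha' hb' hc' hd' he'
  simp only [if_true, show (3 : ℕ) ≠ 4 by norm_num, show (2 : ℕ) ≠ 4 by norm_num,
    show (2 : ℕ) ≠ 3 by norm_num, show (1 : ℕ) ≠ 4 by norm_num, show (1 : ℕ) ≠ 3 by norm_num,
    show (1 : ℕ) ≠ 2 by norm_num, show (0 : ℕ) ≠ 4 by norm_num, show (0 : ℕ) ≠ 3 by norm_num,
    show (0 : ℕ) ≠ 2 by norm_num, show (0 : ℕ) ≠ 1 by norm_num, if_false] at ha' hb' hc' hd' he'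
  exact ⟨q.coeff 2, q.coeff 1, q.coeff 0, h.coeff 2, h.coeff 1, h.coeff 0, ha', hb', hc', hd', he',
    hdq, hdh⟩

/-- Under a coefficientwise factorisation, `f(x,y) = q₁(x,y) q₂(x,y)` as functions. [folklore] -/
theorem eval_eq_mul_of_factors {R : Type*} [CommRing R] {f : BinaryQuartic R}
    {α₁ β₁ γ₁ α₂ β₂ γ₂ : R} (ha : f.a = α₁ * α₂) (hb : f.b = α₁ * β₂ + β₁ * α₂)
    (hc : f.c = α₁ * γ₂ + β₁ * β₂ + γ₁ * α₂) (hd : f.d = β₁ * γ₂ + γ₁ * β₂) (he : f.e = γ₁ * γ₂)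
    (x y : R) :
    f.eval x y = (α₁ * x ^ 2 + β₁ * x * y + γ₁ * y ^ 2) * (α₂ * x ^ 2 + β₂ * x * y + γ₂ * y ^ 2) := by
  simp only [eval, ha, hb, hc, hd, he]
  ring

/-- A positive definite real binary quadratic form `αx² + βxy + γy²` (`α > 0`, `β² < 4αγ`) is
positive at nonzero vectors. [folklore] -/
theorem quadratic_pos {α β γ : ℝ} (hα : 0 < α) (hdisc : β ^ 2 - 4 * α * γ < 0) {x y : ℝ}
    (hxy : x ≠ 0 ∨ y ≠ 0) : 0 < α * x ^ 2 + β * x * y + γ * y ^ 2 := by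
  have key : 4 * α * (α * x ^ 2 + β * x * y + γ * y ^ 2) =
      (2 * α * x + β * y) ^ 2 + (4 * α * γ - β ^ 2) * y ^ 2 := by ring
  have h4 : 0 < 4 * α * γ - β ^ 2 := by linarith
  rcases hxy with hx | hy
  · by_cases hy : y = 0
    · subst hy
      have := sq_pos_of_ne_zero hx
      nlinarith
    · have := sq_pos_of_ne_zero hy
      nlinarith [sq_nonneg (2 * α * x + β * y)]
  · have := sq_pos_of_ne_zero hy
    nlinarith [sq_nonneg (2 * α * x + β * y)]

/-- **Circle normalisation of a positive definite binary quadratic form by `SL₂(ℝ)`**: for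
`q(x,y) = αx² + βxy + γy²` with `α > 0`, `β² < 4αγ`, the matrix `γ = (t 0; u/t 1/t)` (`u = −β/(2α)`,
`t⁴ = (γ − β²/(4α))/α`) has determinant `1` and `q((x,y)γ) = κ (x² + y²)` with `κ = α t² > 0`
(complete the square, then balance the two coefficients by `diag(t, t⁻¹)`). [folklore] -/
theorem exists_circle_normalisation {α β γ : ℝ} (hα : 0 < α) (hdisc : β ^ 2 - 4 * α * γ < 0) :
    ∃ t u κ : ℝ, 0 < t ∧ 0 < κ ∧ u = -β / (2 * α) ∧ κ = α * t ^ 2 ∧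
      ∀ x y : ℝ, α * (x * t + y * (u / t)) ^ 2 + β * (x * t + y * (u / t)) * (y * t⁻¹) +
        γ * (y * t⁻¹) ^ 2 = κ * (x ^ 2 + y ^ 2) := by
  set u : ℝ := -β / (2 * α) with hu
  set γ' : ℝ := γ - β ^ 2 / (4 * α) with hγ'
  have hγ'pos : 0 < γ' := by
    rw [hγ', sub_pos, div_lt_iff₀ (by positivity)]; nlinarith
  set ρ : ℝ := Real.sqrt (γ' / α) with hρ
  have hρpos : 0 < ρ := Real.sqrt_pos.mpr (div_pos hγ'pos hα)
  have hρsq : ρ ^ 2 = γ' / α := Real.sq_sqrt (div_pos hγ'pos hα).le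
  set t : ℝ := Real.sqrt ρ with ht
  have htpos : 0 < t := Real.sqrt_pos.mpr hρpos
  have htsq : t ^ 2 = ρ := Real.sq_sqrt hρpos.le
  -- completing the square
  have h1 : ∀ x y : ℝ, α * (x + u * y) ^ 2 + β * (x + u * y) * y + γ * y ^ 2 =
      α * x ^ 2 + γ' * y ^ 2 := by
    intro x y; rw [hu, hγ']; field_simp; ring
  -- balancing: `α t² = γ'/t² = α ρ`
  have hγ'eq : γ' = α * ρ ^ 2 := by rw [hρsq]; field_simp
  refine ⟨t, u, α * t ^ 2, htpos, by positivity, rfl, rfl, fun x y ↦ ?_⟩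
  have ht0 : t ≠ 0 := htpos.ne'
  have := h1 (x * t) (y * t⁻¹)
  have e1 : x * t + y * (u / t) = x * t + u * (y * t⁻¹) := by rw [div_eq_mul_inv]; ring
  rw [e1, this, htsq, hγ'eq]
  field_simp
  rw [← htsq]
  ring

/-- **A positive definite real binary quartic form is `SL₂(ℝ)`-equivalent to a form
`(x² + y²)(Px² + Qxy + Ry²)` with `P, R > 0` and `Q² < 4PR`**, i.e. to `⟨P, Q, P + R, Q, R⟩`
(factor into two definite quadratics and normalise the first one to `κ(x² + y²)`). This is the
existence half of Bhargava–Shankar's fact 2 for the orbit "from `V_ℝ^{(2+)}`" (§2.1), with a normal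
form chosen here for bounded coefficients (the printed Table 1 of fundamental sets is not
reproduced in the held text). [cite: BhargavaShankarAnnals2015, §2.1 (fact 2, V_ℝ^{(2+)})] -/
theorem exists_subst_eq_circleForm_of_posDef {f : BinaryQuartic ℝ}
    (hpos : ∀ x y : ℝ, (x ≠ 0 ∨ y ≠ 0) → 0 < f.eval x y) :
    ∃ γ : Matrix (Fin 2) (Fin 2) ℝ, γ.det = 1 ∧ ∃ P Q R : ℝ,
      f.subst γ = ⟨P, Q, P + R, Q, R⟩ ∧ 0 < P ∧ 0 < R ∧ Q ^ 2 < 4 * P * R := by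
  have ha : 0 < f.a := by simpa [eval] using hpos 1 0 (Or.inl one_ne_zero)
  have hnoroot : ∀ x : ℝ, f.toPoly.eval x ≠ 0 := fun x ↦ by
    rw [eval_toPoly]; exact (hpos x 1 (Or.inr one_ne_zero)).ne'
  obtain ⟨α₁, β₁, γ₁, α₂, β₂, γ₂, hfa, hfb, hfc, hfd, hfe, hd₁, hd₂⟩ :=
    exists_quadratic_factors ha.ne' hnoroot
  -- normalise signs so that `α₁ > 0` (and then `α₂ > 0`)
  obtain ⟨α₁, β₁, γ₁, α₂, β₂, γ₂, hfa, hfb, hfc, hfd, hfe, hd₁, hd₂, hα₁⟩ :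
      ∃ α₁ β₁ γ₁ α₂ β₂ γ₂ : ℝ, f.a = α₁ * α₂ ∧ f.b = α₁ * β₂ + β₁ * α₂ ∧
        f.c = α₁ * γ₂ + β₁ * β₂ + γ₁ * α₂ ∧ f.d = β₁ * γ₂ + γ₁ * β₂ ∧ f.e = γ₁ * γ₂ ∧
        β₁ ^ 2 - 4 * α₁ * γ₁ < 0 ∧ β₂ ^ 2 - 4 * α₂ * γ₂ < 0 ∧ 0 < α₁ := by
    have hα₁0 : α₁ ≠ 0 := by rintro rfl; nlinarith [sq_nonneg β₁]
    rcases lt_or_gt_of_ne hα₁0 with hneg | hposα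
    · refine ⟨-α₁, -β₁, -γ₁, -α₂, -β₂, -γ₂, by rw [hfa]; ring, by rw [hfb]; ring,
        by rw [hfc]; ring, by rw [hfd]; ring, by rw [hfe]; ring, by linarith, by linarith,
        by linarith⟩
    · exact ⟨α₁, β₁, γ₁, α₂, β₂, γ₂, hfa, hfb, hfc, hfd, hfe, hd₁, hd₂, hposα⟩
  have hα₂ : 0 < α₂ := by
    by_contra hle; push Not at hle
    have : f.a ≤ 0 := by rw [hfa]; exact mul_nonpos_of_nonneg_of_nonpos hα₁.le hle
    linarith
  -- normalise the first factor to `κ (x² + y²)`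
  obtain ⟨t, u, κ, ht, hκ, hu, hκt, hcirc⟩ := exists_circle_normalisation hα₁ hd₁
  set γm : Matrix (Fin 2) (Fin 2) ℝ := !![t, 0; u / t, t⁻¹] with hγm
  have hdet : γm.det = 1 := by
    rw [hγm, Matrix.det_fin_two]
    simp only [Matrix.of_apply, Matrix.cons_val', Matrix.cons_val_zero, Matrix.cons_val_one,
      Matrix.cons_val_fin_one, Matrix.empty_val']
    rw [mul_inv_cancel₀ ht.ne']
    ring
  -- the second factor after the substitution: `P' x² + Q' xy + R' y²`
  set P' : ℝ := α₂ * t ^ 2 with hP'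
  set Q' : ℝ := 2 * α₂ * u + β₂ with hQ'
  set R' : ℝ := (α₂ * u ^ 2 + β₂ * u + γ₂) * t⁻¹ ^ 2 with hR'
  have hsecond : ∀ x y : ℝ, α₂ * (x * t + y * (u / t)) ^ 2 +
      β₂ * (x * t + y * (u / t)) * (y * t⁻¹) + γ₂ * (y * t⁻¹) ^ 2 =
      P' * x ^ 2 + Q' * x * y + R' * y ^ 2 := by
    intro x y; rw [hP', hQ', hR', div_eq_mul_inv]; field_simp; ring
  have hP'pos : 0 < P' := by positivity
  have hR'pos : 0 < R' := by
    have h1 : 0 < α₂ * u ^ 2 + β₂ * u + γ₂ := by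
      have := quadratic_pos hα₂ hd₂ (x := u) (y := 1) (Or.inr one_ne_zero)
      simpa using this
    positivity
  have hdisc' : Q' ^ 2 - 4 * P' * R' = β₂ ^ 2 - 4 * α₂ * γ₂ := by
    rw [hP', hQ', hR']; field_simp; ring
  -- the substituted form, identified through `f(x,1)`
  set g : BinaryQuartic ℝ := ⟨κ * P', κ * Q', κ * P' + κ * R', κ * Q', κ * R'⟩ with hg
  have hsubst : f.subst γm = g := by
    apply toPoly_injective
    apply Polynomial.funext
    intro x
    rw [eval_toPoly, eval_toPoly, eval_subst]
    simp only [hγm, Matrix.of_apply, Matrix.cons_val', Matrix.cons_val_zero, Matrix.cons_val_one,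
      Matrix.cons_val_fin_one, Matrix.empty_val', one_mul, mul_zero, zero_add]
    rw [eval_eq_mul_of_factors hfa hfb hfc hfd hfe]
    have e1 := hcirc x 1
    have e2 := hsecond x 1
    simp only [one_mul, one_pow, mul_one] at e1 e2
    rw [e1, e2, hg]
    simp only [eval]
    ring
  refine ⟨γm, hdet, κ * P', κ * Q', κ * R', hsubst, by positivity, by positivity, ?_⟩
  have : (κ * Q') ^ 2 - 4 * (κ * P') * (κ * R') = κ ^ 2 * (β₂ ^ 2 - 4 * α₂ * γ₂) := by
    rw [← hdisc']; ring
  nlinarith [sq_nonneg κ, mul_pos (pow_pos hκ 2) (neg_pos.mpr hd₂)]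

/-- **The invariant `I` of `(x² + y²)(Px² + Qxy + Ry²)`** is `12PR − 3Q² + (P + R)²`. [folklore] -/
theorem I_circleForm (P Q R : ℝ) :
    (⟨P, Q, P + R, Q, R⟩ : BinaryQuartic ℝ).I = 12 * P * R - 3 * Q ^ 2 + (P + R) ^ 2 := by
  simp only [I]; ring

/-- **Coefficient bounds for the definite normal form in terms of `I` alone**: if `P, R > 0` and
`Q² < 4PR` then `(P + R)² < I`, `|Q| < P + R` and `P + R < I^{1/2}` for the form
`(x² + y²)(Px² + Qxy + Ry²)`; so on `{H = 1}` (where `|I| ≤ 1`) all its coefficients lie in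
`[−2, 2]` — the boundedness of the fundamental set for `V_ℝ^{(2±)}` (Bhargava–Shankar 2015, §2.1:
"the coefficients of all binary quartic forms in these `L_V^{(i)}` are uniformly bounded").
[cite: BhargavaShankarAnnals2015, §2.1 (L_V^{(i)} lie in a compact set)] -/
theorem circleForm_bounds {P Q R : ℝ} (hP : 0 < P) (hR : 0 < R) (hQ : Q ^ 2 < 4 * P * R) :
    (P + R) ^ 2 < (⟨P, Q, P + R, Q, R⟩ : BinaryQuartic ℝ).I ∧ |Q| < P + R ∧
      P + R < Real.sqrt (⟨P, Q, P + R, Q, R⟩ : BinaryQuartic ℝ).I := by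
  rw [I_circleForm]
  have h1 : (P + R) ^ 2 < 12 * P * R - 3 * Q ^ 2 + (P + R) ^ 2 := by nlinarith
  have h2 : |Q| < P + R := by
    have hsq : Q ^ 2 < (P + R) ^ 2 := by nlinarith [sq_nonneg (P - R)]
    exact abs_lt.mpr (abs_lt_of_sq_lt_sq' hsq (by positivity))
  exact ⟨h1, h2, Real.lt_sqrt_of_sq_lt h1⟩

/-- **Every definite real binary quartic form is `SL₂(ℝ)`-equivalent to `±(x² + y²)(Px² + Qxy + Ry²)`**
with `P, R > 0`, `Q² < 4PR` (sign `+` for positive, `−` for negative definite forms: the orbits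
"from `V_ℝ^{(2+)}` and `V_ℝ^{(2−)}`" of Bhargava–Shankar 2015, §2.1, fact 2, existence half).
[cite: BhargavaShankarAnnals2015, §2.1 (fact 2, V_ℝ^{(2±)})] -/
theorem exists_subst_eq_smul_circleForm_of_isDefinite {f : BinaryQuartic ℝ} (hdef : f.IsDefinite) :
    ∃ γ : Matrix (Fin 2) (Fin 2) ℝ, γ.det = 1 ∧ ∃ ε P Q R : ℝ, (ε = 1 ∨ ε = -1) ∧
      f.subst γ = ε • ⟨P, Q, P + R, Q, R⟩ ∧ 0 < P ∧ 0 < R ∧ Q ^ 2 < 4 * P * R := by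
  rcases hdef with hpos | hneg
  · obtain ⟨γ, hγ, P, Q, R, hPQR, hP, hR, hQ⟩ := exists_subst_eq_circleForm_of_posDef hpos
    exact ⟨γ, hγ, 1, P, Q, R, Or.inl rfl, by rw [one_smul]; exact hPQR, hP, hR, hQ⟩
  · have hpos : ∀ x y : ℝ, (x ≠ 0 ∨ y ≠ 0) → 0 < ((-1 : ℝ) • f).eval x y := fun x y hxy ↦ by
      rw [eval_smul]; have := hneg x y hxy; linarith
    obtain ⟨γ, hγ, P, Q, R, hPQR, hP, hR, hQ⟩ := exists_subst_eq_circleForm_of_posDef hpos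
    refine ⟨γ, hγ, -1, P, Q, R, Or.inr rfl, ?_, hP, hR, hQ⟩
    rw [smul_subst] at hPQR
    rw [← hPQR, smul_smul]; norm_num

end Definite

end BinaryQuartic

end Literature.NumberTheory.EllipticCurves

end
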